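import Literature.Analysis.FunctionSpaces.SmoothParametricIntegral
import Literature.NumberTheory.LFunctions.XiHeatRayGaussian
import Mathlib.Analysis.SpecialFunctions.ExpDeriv
import Mathlib.Analysis.SpecialFunctions.Integrals.Basic
import Mathlib.MeasureTheory.Integral.IntervalIntegral.FundThmCalculus
import HarnessLib

/-!
# Linear transport with absorption and source: the Duhamel formula along characteristics

Topic: MathematicalPhysics / KineticTheory. Infrastructure for the truncated problems of the
DiPerna–Lions scheme (`truncatedProblem_globalExistence`, CIP 1994 Lemma 5.3.6): the iterates of
the (positivity preserving) scheme solve linear kinetic transport equations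
`∂ₜU + v·∇ₓU = Γ - Λ U`, `U(0) = f₀`, given by the Duhamel formula along the free-transport
characteristics,
`U(t,x,v) = f₀(x - tv, v) e^{-∫₀ᵗ Λ♯} + ∫₀ᵗ e^{-∫ₛᵗ Λ♯} Γ(s, x - (t-s)v, v) ds`,
`Λ♯(σ) = Λ(σ, x - (t-σ)v, v)`. This file treats the formula for smooth `f₀, Λ, Γ` (the function
`U` enters through the hypothesis `hU` stating the formula, so that no definition is needed):
smoothness, the equation, and the level-zero weighted sup bounds, positivity and difference
bounds used in the Picard iteration. Everything is proved; theorems only.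

* `contDiff_absorptionIntegral`, `contDiff_absorptionIntegral₂` (substitution `σ = sθ` and the
  tree's `contDiff_parametric_intervalIntegral`), `contDiff_duhamel`, `duhamel_zero`.
* `duhamel_transport_eq`: `∂ₜU + D_xU·v = Γ - ΛU` pointwise (the scalar ODE along the
  characteristic `τ ↦ (τ, x₀ + τv, v)` and the chain rule).
* `norm_le_shift`, `weight_le_shift` (weight transfer `‖(x,v)‖ ≤ (1+|τ|)‖(x-τv,v)‖` for the max
  norm), `integral_exp_mul_le` (and the tree's
  `Literature.NumberTheory.LFunctions.abs_exp_neg_sub_exp_neg_le`, `|e^{-a} - e^{-b}| ≤ |a - b|`).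
* `duhamel_weighted_bound_zero`: `(1+‖z‖)^k |U(t)| ≤ (1+T)^k (F₀ + M e^{βt}/β)` from
  `(1+‖z‖)^k|Γ(s)| ≤ M e^{βs}`, `Λ ≥ 0`; `duhamel_lower_bound`: `U ≥ f₀(x-tv,v) e^{-C₀t}`;
  `duhamel_weighted_diff_zero`: `(1+‖z‖)^K |U - U'|(t) ≤ (1+T)^K (F₀+1+G'T) N t^{m+1}/(m+1)` from
  differences `≤ N s^m` of the coefficients.

## References

* C. Cercignani, R. Illner, M. Pulvirenti, *The Mathematical Theory of Dilute Gases*, Springer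
  (1994), §5.3 Lemma 5.3.6 and Step 6, pp. 145–146 (the iteration `Tf^{n+1} = Q̃(fⁿ)`).
* L. C. Evans, *Partial Differential Equations*, 2nd ed. (2010), §3.2 (characteristics).
-/

noncomputable section

open MeasureTheory Set Filter Topology Metric intervalIntegral
open scoped ContDiff

namespace Literature.MathematicalPhysics.KineticTheory

variable {E : Type*} [NormedAddCommGroup E] [NormedSpace ℝ E] [FiniteDimensional ℝ E]

/-! ## Smoothness of the Duhamel formula -/

section Smooth

variable {Λ Γ : ℝ × E × E → ℝ} {f₀ : E × E → ℝ}

/-- The absorption integral `∫₀ˢ Λ(σ, x - (t - σ) v, v) dσ` is smooth in `(s, t, x, v)`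
(substitution `σ = sθ` and differentiation under the integral sign). [folklore] -/
theorem contDiff_absorptionIntegral (hΛ : ContDiff ℝ ∞ Λ) :
    ContDiff ℝ ∞ fun q : ℝ × ℝ × E × E =>
      ∫ σ in (0 : ℝ)..q.1, Λ (σ, q.2.2.1 - (q.2.1 - σ) • q.2.2.2, q.2.2.2) := by
  -- `∫₀ˢ F(σ) dσ = s ∫₀¹ F(sθ) dθ`
  have hsub : ∀ q : ℝ × ℝ × E × E, ∫ σ in (0 : ℝ)..q.1, Λ (σ, q.2.2.1 - (q.2.1 - σ) • q.2.2.2, q.2.2.2) =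
      q.1 * ∫ θ in (0 : ℝ)..1, Λ (q.1 * θ, q.2.2.1 - (q.2.1 - q.1 * θ) • q.2.2.2, q.2.2.2) := by
    intro q
    have h := intervalIntegral.smul_integral_comp_mul_left
      (fun σ => Λ (σ, q.2.2.1 - (q.2.1 - σ) • q.2.2.2, q.2.2.2)) q.1 (a := 0) (b := 1)
    simp only [mul_zero, mul_one, smul_eq_mul] at h
    exact h.symm
  simp_rw [hsub]
  refine contDiff_fst.mul ?_
  refine Literature.Analysis.FunctionSpaces.contDiff_parametric_intervalIntegral
    (H := fun r : ℝ × (ℝ × ℝ × E × E) => Λ (r.2.1 * r.1, r.2.2.2.1 - (r.2.2.1 - r.2.1 * r.1) • r.2.2.2.2, r.2.2.2.2)) ?_ 0 1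
  refine hΛ.comp ?_
  refine ((contDiff_fst.comp contDiff_snd).mul contDiff_fst).prodMk ((?_ : ContDiff ℝ ∞ _).prodMk ?_)
  · exact (contDiff_fst.comp (contDiff_snd.comp (contDiff_snd.comp contDiff_snd))).sub
      (((contDiff_fst.comp (contDiff_snd.comp contDiff_snd)).sub
        ((contDiff_fst.comp contDiff_snd).mul contDiff_fst)).smul
        (contDiff_snd.comp (contDiff_snd.comp (contDiff_snd.comp contDiff_snd))))
  · exact contDiff_snd.comp (contDiff_snd.comp (contDiff_snd.comp contDiff_snd))

/-- The absorption integral between two times, `∫ₛᵗ Λ(σ, x - (t - σ) v, v) dσ`, is smooth in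
`(s, t, x, v)`. [folklore] -/
theorem contDiff_absorptionIntegral₂ (hΛ : ContDiff ℝ ∞ Λ) :
    ContDiff ℝ ∞ fun q : ℝ × ℝ × E × E =>
      ∫ σ in q.1..q.2.1, Λ (σ, q.2.2.1 - (q.2.1 - σ) • q.2.2.2, q.2.2.2) := by
  have hI := contDiff_absorptionIntegral hΛ
  -- `∫ₛᵗ = ∫₀ᵗ - ∫₀ˢ`
  have hsplit : ∀ q : ℝ × ℝ × E × E, ∫ σ in q.1..q.2.1, Λ (σ, q.2.2.1 - (q.2.1 - σ) • q.2.2.2, q.2.2.2) =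
      (∫ σ in (0 : ℝ)..q.2.1, Λ (σ, q.2.2.1 - (q.2.1 - σ) • q.2.2.2, q.2.2.2)) -
        ∫ σ in (0 : ℝ)..q.1, Λ (σ, q.2.2.1 - (q.2.1 - σ) • q.2.2.2, q.2.2.2) := by
    intro q
    have hc : Continuous fun σ : ℝ => Λ (σ, q.2.2.1 - (q.2.1 - σ) • q.2.2.2, q.2.2.2) :=
      hΛ.continuous.comp (continuous_id.prodMk ((continuous_const.sub
        ((continuous_const.sub continuous_id).smul continuous_const)).prodMk continuous_const))
    rw [intervalIntegral.integral_interval_sub_left (hc.intervalIntegrable _ _) (hc.intervalIntegrable _ _)]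
  simp_rw [hsplit]
  refine (hI.comp (?_ : ContDiff ℝ ∞ fun q : ℝ × ℝ × E × E => (q.2.1, q.2.1, q.2.2.1, q.2.2.2))).sub
    (hI.comp (?_ : ContDiff ℝ ∞ fun q : ℝ × ℝ × E × E => (q.1, q.2.1, q.2.2.1, q.2.2.2)))
  · exact (contDiff_fst.comp contDiff_snd).prodMk contDiff_snd
  · exact contDiff_fst.prodMk contDiff_snd

/-- **The Duhamel formula defines a smooth function.** For smooth `f₀`, `Λ`, `Γ`, the function
`U(t,x,v) = f₀(x - tv, v) e^{-∫₀ᵗ Λ♯} + ∫₀ᵗ e^{-∫ₛᵗ Λ♯} Γ(s, x - (t-s)v, v) ds`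
(`Λ♯(σ) = Λ(σ, x - (t-σ)v, v)`) is `C^∞` on `ℝ × E × E`. [folklore] -/
theorem contDiff_duhamel (hf₀ : ContDiff ℝ ∞ f₀) (hΛ : ContDiff ℝ ∞ Λ) (hΓ : ContDiff ℝ ∞ Γ)
    {U : ℝ × E × E → ℝ}
    (hU : ∀ t x v, U (t, x, v) =
      f₀ (x - t • v, v) * Real.exp (-(∫ σ in (0 : ℝ)..t, Λ (σ, x - (t - σ) • v, v))) +
        ∫ s in (0 : ℝ)..t, Real.exp (-(∫ σ in s..t, Λ (σ, x - (t - σ) • v, v))) * Γ (s, x - (t - s) • v, v)) :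
    ContDiff ℝ ∞ U := by
  have hJ := contDiff_absorptionIntegral₂ hΛ
  -- the Duhamel integrand `K(s, t, x, v)`
  set K : ℝ × ℝ × E × E → ℝ := fun q =>
    Real.exp (-(∫ σ in q.1..q.2.1, Λ (σ, q.2.2.1 - (q.2.1 - σ) • q.2.2.2, q.2.2.2))) *
      Γ (q.1, q.2.2.1 - (q.2.1 - q.1) • q.2.2.2, q.2.2.2) with hK
  have hKs : ContDiff ℝ ∞ K := by
    refine (Real.contDiff_exp.comp hJ.neg).mul (hΓ.comp ?_)
    exact contDiff_fst.prodMk (((contDiff_fst.comp (contDiff_snd.comp contDiff_snd)).sub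
      ((contDiff_fst.comp contDiff_snd).sub contDiff_fst |>.smul
        (contDiff_snd.comp (contDiff_snd.comp contDiff_snd)))).prodMk
      (contDiff_snd.comp (contDiff_snd.comp contDiff_snd)))
  -- `∫₀ᵗ K(s, ·) ds = t ∫₀¹ K(tθ, ·) dθ`
  have hduh : ContDiff ℝ ∞ fun p : ℝ × E × E => ∫ s in (0 : ℝ)..p.1, K (s, p) := by
    have hsub : ∀ p : ℝ × E × E, ∫ s in (0 : ℝ)..p.1, K (s, p) = p.1 * ∫ θ in (0 : ℝ)..1, K (p.1 * θ, p) := by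
      intro p
      have h := intervalIntegral.smul_integral_comp_mul_left (fun s => K (s, p)) p.1 (a := 0) (b := 1)
      simp only [mul_zero, mul_one, smul_eq_mul] at h
      exact h.symm
    simp_rw [hsub]
    refine contDiff_fst.mul (Literature.Analysis.FunctionSpaces.contDiff_parametric_intervalIntegral
      (H := fun r : ℝ × (ℝ × E × E) => K (r.2.1 * r.1, r.2)) (hKs.comp ?_) 0 1)
    exact ((contDiff_fst.comp contDiff_snd).mul contDiff_fst).prodMk contDiff_snd
  have hA : ContDiff ℝ ∞ fun p : ℝ × E × E => ∫ σ in (0 : ℝ)..p.1, Λ (σ, p.2.1 - (p.1 - σ) • p.2.2, p.2.2) :=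
    hJ.comp (contDiff_const.prodMk contDiff_id : ContDiff ℝ ∞ fun p : ℝ × E × E => ((0 : ℝ), p))
  have hfirst : ContDiff ℝ ∞ fun p : ℝ × E × E =>
      f₀ (p.2.1 - p.1 • p.2.2, p.2.2) * Real.exp (-(∫ σ in (0 : ℝ)..p.1, Λ (σ, p.2.1 - (p.1 - σ) • p.2.2, p.2.2))) :=
    (hf₀.comp ((contDiff_snd.fst.sub (contDiff_fst.smul contDiff_snd.snd)).prodMk contDiff_snd.snd)).mul
      (Real.contDiff_exp.comp hA.neg)
  have hUeq : U = fun p : ℝ × E × E =>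
      f₀ (p.2.1 - p.1 • p.2.2, p.2.2) * Real.exp (-(∫ σ in (0 : ℝ)..p.1, Λ (σ, p.2.1 - (p.1 - σ) • p.2.2, p.2.2))) +
        ∫ s in (0 : ℝ)..p.1, K (s, p) := by
    funext p
    obtain ⟨t, x, v⟩ := p
    rw [hU t x v]
  rw [hUeq]
  exact hfirst.add hduh

omit [FiniteDimensional ℝ E] in
/-- The Duhamel formula takes the initial value `f₀`. [folklore] -/
theorem duhamel_zero {U : ℝ × E × E → ℝ}
    (hU : ∀ t x v, U (t, x, v) =
      f₀ (x - t • v, v) * Real.exp (-(∫ σ in (0 : ℝ)..t, Λ (σ, x - (t - σ) • v, v))) +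
        ∫ s in (0 : ℝ)..t, Real.exp (-(∫ σ in s..t, Λ (σ, x - (t - σ) • v, v))) * Γ (s, x - (t - s) • v, v))
    (x v : E) : U (0, x, v) = f₀ (x, v) := by
  rw [hU]
  simp

end Smooth

/-! ## The transport equation -/

section Equation

variable {Λ Γ : ℝ × E × E → ℝ} {f₀ : E × E → ℝ}

/-- **The Duhamel formula solves the linear transport equation with absorption and source**:
`∂ₜU + v·∇ₓU = Γ - Λ U` pointwise (differentiate along the characteristic `τ ↦ (τ, x₀ + τv, v)`,
on which the formula is an explicit solution of the scalar ODE `φ' = -λφ + γ`). [folklore] -/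
theorem duhamel_transport_eq (hf₀ : ContDiff ℝ ∞ f₀) (hΛ : ContDiff ℝ ∞ Λ) (hΓ : ContDiff ℝ ∞ Γ)
    {U : ℝ × E × E → ℝ}
    (hU : ∀ t x v, U (t, x, v) =
      f₀ (x - t • v, v) * Real.exp (-(∫ σ in (0 : ℝ)..t, Λ (σ, x - (t - σ) • v, v))) +
        ∫ s in (0 : ℝ)..t, Real.exp (-(∫ σ in s..t, Λ (σ, x - (t - σ) • v, v))) * Γ (s, x - (t - s) • v, v))
    (t : ℝ) (x v : E) :
    deriv (fun τ => U (τ, x, v)) t + fderiv ℝ (fun y => U (t, y, v)) x v =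
      Γ (t, x, v) - Λ (t, x, v) * U (t, x, v) := by
  have hUs := contDiff_duhamel hf₀ hΛ hΓ hU
  have h1 : (∞ : WithTop ℕ∞) ≠ 0 := by exact_mod_cast WithTop.coe_ne_zero.2 (by decide)
  have hUd : Differentiable ℝ U := hUs.differentiable h1
  set x₀ : E := x - t • v with hx₀
  -- the data along the characteristic
  set lam : ℝ → ℝ := fun σ => Λ (σ, x₀ + σ • v, v) with hlam
  set gam : ℝ → ℝ := fun s => Γ (s, x₀ + s • v, v) with hgam
  have hlc : Continuous lam := hΛ.continuous.comp
    (continuous_id.prodMk ((continuous_const.add (continuous_id.smul continuous_const)).prodMk continuous_const))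
  have hgc : Continuous gam := hΓ.continuous.comp
    (continuous_id.prodMk ((continuous_const.add (continuous_id.smul continuous_const)).prodMk continuous_const))
  set a : ℝ → ℝ := fun τ => ∫ σ in (0 : ℝ)..τ, lam σ with ha
  have ha_deriv : ∀ τ, HasDerivAt a (lam τ) τ := fun τ =>
    intervalIntegral.integral_hasDerivAt_right (hlc.intervalIntegrable _ _)
      hlc.aestronglyMeasurable.stronglyMeasurableAtFilter hlc.continuousAt
  have hac : Continuous a := continuous_iff_continuousAt.2 fun τ => (ha_deriv τ).continuousAt
  -- the formula along the characteristic
  set φ : ℝ → ℝ := fun τ => U (τ, x₀ + τ • v, v) with hφ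
  have hchar : ∀ τ σ : ℝ, x₀ + τ • v - (τ - σ) • v = x₀ + σ • v := fun τ σ => by
    rw [sub_smul]; abel
  have hJ : ∀ s τ : ℝ, ∫ σ in s..τ, lam σ = a τ - a s := fun s τ =>
    (intervalIntegral.integral_interval_sub_left (hlc.intervalIntegrable _ _) (hlc.intervalIntegrable _ _)).symm
  set ψ : ℝ → ℝ := fun τ => Real.exp (-a τ) * (f₀ (x₀, v) + ∫ s in (0 : ℝ)..τ, Real.exp (a s) * gam s) with hψ
  have hφ_eq : ∀ τ, φ τ = ψ τ := by
    intro τ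
    have hlamσ : ∀ σ, Λ (σ, x₀ + σ • v, v) = lam σ := fun σ => rfl
    have hgamσ : ∀ σ, Γ (σ, x₀ + σ • v, v) = gam σ := fun σ => rfl
    have ha' : ∀ r, ∫ σ in (0 : ℝ)..r, lam σ = a r := fun r => rfl
    have h0 : U (τ, x₀ + τ • v, v) = f₀ (x₀, v) * Real.exp (-(a τ)) +
        ∫ s in (0 : ℝ)..τ, Real.exp (-(a τ - a s)) * gam s := by
      rw [hU τ (x₀ + τ • v) v]
      have e1 : x₀ + τ • v - τ • v = x₀ := add_sub_cancel_right _ _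
      simp only [hchar, e1, hlamσ, hgamσ, hJ]
      have e2 : ∫ σ in (0 : ℝ)..τ, lam σ = a τ := rfl
      have e3 : a τ - a 0 = a τ := by
        have : a 0 = 0 := by simp only [ha, intervalIntegral.integral_same]
        rw [this, sub_zero]
      simp only [e3]
    show U (τ, x₀ + τ • v, v) = ψ τ
    rw [h0, hψ]
    simp only
    rw [mul_add, mul_comm (Real.exp _) (f₀ _), ← intervalIntegral.integral_const_mul]
    congr 1
    refine intervalIntegral.integral_congr fun s _ => ?_
    rw [← mul_assoc, ← Real.exp_add]
    congr 2
    ring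
  -- the scalar ODE `ψ' = -λ ψ + γ`
  have hψ_deriv : HasDerivAt ψ (-lam t * ψ t + gam t) t := by
    have hF : HasDerivAt (fun τ => ∫ s in (0 : ℝ)..τ, Real.exp (a s) * gam s) (Real.exp (a t) * gam t) t := by
      have hc : Continuous fun s => Real.exp (a s) * gam s := (Real.continuous_exp.comp hac).mul hgc
      exact intervalIntegral.integral_hasDerivAt_right (hc.intervalIntegrable _ _)
        hc.aestronglyMeasurable.stronglyMeasurableAtFilter hc.continuousAt
    have hE : HasDerivAt (fun τ => Real.exp (-a τ)) (Real.exp (-a t) * (-lam t)) t :=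
      (ha_deriv t).neg.exp
    have h := hE.mul (hF.const_add (f₀ (x₀, v)))
    refine h.congr_deriv ?_
    have hee : Real.exp (-a t) * Real.exp (a t) = 1 := by rw [← Real.exp_add, neg_add_cancel, Real.exp_zero]
    simp only [hψ]
    calc Real.exp (-a t) * -lam t * (f₀ (x₀, v) + ∫ s in (0 : ℝ)..t, Real.exp (a s) * gam s) +
          Real.exp (-a t) * (Real.exp (a t) * gam t)
        = -lam t * (Real.exp (-a t) * (f₀ (x₀, v) + ∫ s in (0 : ℝ)..t, Real.exp (a s) * gam s)) +
            (Real.exp (-a t) * Real.exp (a t)) * gam t := by ring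
      _ = _ := by rw [hee, one_mul]
  have hφ_deriv : HasDerivAt φ (-lam t * φ t + gam t) t := by
    have heq : φ = ψ := funext hφ_eq
    rw [heq]
    exact hψ_deriv
  -- the chain rule along the characteristic
  set c : ℝ → ℝ × E × E := fun τ => (τ, x₀ + τ • v, v) with hc
  have hc_deriv : HasDerivAt c ((1 : ℝ), v, (0 : E)) t := by
    refine (hasDerivAt_id t).prodMk ((?_ : HasDerivAt (fun τ => x₀ + τ • v) v t).prodMk (hasDerivAt_const t v))
    simpa using ((hasDerivAt_id t).smul_const v).const_add x₀
  have hct : c t = (t, x, v) := by simp only [hc, hx₀, sub_add_cancel]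
  have hchain : HasDerivAt φ (fderiv ℝ U (t, x, v) ((1 : ℝ), v, (0 : E))) t := by
    have h := (hUd (c t)).hasFDerivAt.comp_hasDerivAt t hc_deriv
    rw [hct] at h
    exact h
  have hkey : fderiv ℝ U (t, x, v) ((1 : ℝ), v, (0 : E)) = -lam t * φ t + gam t := hchain.unique hφ_deriv
  -- the two partial derivatives
  have hdt : deriv (fun τ => U (τ, x, v)) t = fderiv ℝ U (t, x, v) ((1 : ℝ), (0 : E), (0 : E)) := by
    have hc' : HasDerivAt (fun τ : ℝ => ((τ, x, v) : ℝ × E × E)) ((1 : ℝ), (0 : E), (0 : E)) t :=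
      (hasDerivAt_id t).prodMk ((hasDerivAt_const t x).prodMk (hasDerivAt_const t v))
    exact ((hUd (t, x, v)).hasFDerivAt.comp_hasDerivAt t hc').deriv
  have hdx : fderiv ℝ (fun y => U (t, y, v)) x v = fderiv ℝ U (t, x, v) ((0 : ℝ), v, (0 : E)) := by
    have hc' : HasFDerivAt (fun y : E => ((t, y, v) : ℝ × E × E))
        ((ContinuousLinearMap.inr ℝ ℝ (E × E)).comp (ContinuousLinearMap.inl ℝ E E)) x := by
      refine (hasFDerivAt_const t x).prodMk ((hasFDerivAt_id x).prodMk (hasFDerivAt_const v x)) |>.congr_fderiv ?_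
      ext y <;> simp
    have h2 : HasFDerivAt (fun y : E => U (t, y, v))
        ((fderiv ℝ U (t, x, v)).comp ((ContinuousLinearMap.inr ℝ ℝ (E × E)).comp (ContinuousLinearMap.inl ℝ E E))) x :=
      (hUd (t, x, v)).hasFDerivAt.comp x hc'
    rw [h2.fderiv]
    simp
  have hsum : fderiv ℝ U (t, x, v) ((1 : ℝ), v, (0 : E)) =
      fderiv ℝ U (t, x, v) ((1 : ℝ), (0 : E), (0 : E)) + fderiv ℝ U (t, x, v) ((0 : ℝ), v, (0 : E)) := by
    rw [← ContinuousLinearMap.map_add]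
    simp
  have hφt : φ t = U (t, x, v) := by simp only [hφ, hx₀, sub_add_cancel]
  rw [hdt, hdx, ← hsum, hkey, hφt]
  simp only [hlam, hgam, hx₀, sub_add_cancel]
  ring

end Equation

/-! ## Elementary inequalities -/

section Ineq

omit [FiniteDimensional ℝ E] in
/-- **Weight transfer along characteristics**: `‖(x, v)‖ ≤ (1 + |τ|) ‖(x - τv, v)‖` for the max
norm on `E × E`. [folklore] -/
theorem norm_le_shift (x v : E) (τ : ℝ) : ‖(x, v)‖ ≤ (1 + |τ|) * ‖(x - τ • v, v)‖ := by
  have hv : ‖v‖ ≤ ‖(x - τ • v, v)‖ := norm_snd_le (x - τ • v, v)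
  have hx' : ‖x - τ • v‖ ≤ ‖(x - τ • v, v)‖ := norm_fst_le (x - τ • v, v)
  have hx : ‖x‖ ≤ (1 + |τ|) * ‖(x - τ • v, v)‖ := by
    calc ‖x‖ = ‖(x - τ • v) + τ • v‖ := by rw [sub_add_cancel]
      _ ≤ ‖x - τ • v‖ + |τ| * ‖v‖ := by
          refine (norm_add_le _ _).trans (add_le_add le_rfl ?_)
          rw [norm_smul, Real.norm_eq_abs]
      _ ≤ ‖(x - τ • v, v)‖ + |τ| * ‖(x - τ • v, v)‖ :=
          add_le_add hx' (mul_le_mul_of_nonneg_left hv (abs_nonneg _))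
      _ = (1 + |τ|) * ‖(x - τ • v, v)‖ := by ring
  rw [Prod.norm_def]
  refine max_le hx (hv.trans ?_)
  have h0 : 0 ≤ ‖(x - τ • v, v)‖ := norm_nonneg _
  nlinarith [abs_nonneg τ]

omit [FiniteDimensional ℝ E] in
/-- Weight transfer for the weights `(1 + ‖z‖)^k`. [folklore] -/
theorem weight_le_shift (x v : E) {τ T : ℝ} (hτ : |τ| ≤ T) (k : ℕ) :
    (1 + ‖(x, v)‖) ^ k ≤ (1 + T) ^ k * (1 + ‖(x - τ • v, v)‖) ^ k := by
  rw [← mul_pow]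
  refine pow_le_pow_left₀ (by positivity) ?_ _
  have h := norm_le_shift x v τ
  have h0 : 0 ≤ ‖(x - τ • v, v)‖ := norm_nonneg _
  have hT : 0 ≤ T := (abs_nonneg τ).trans hτ
  nlinarith [mul_le_mul_of_nonneg_right hτ h0]

/-- `∫₀ᵗ M e^{βs} ds ≤ M e^{βt} / β` for `M ≥ 0`, `β > 0`, `t ≥ 0`. [folklore] -/
theorem integral_exp_mul_le {M β t : ℝ} (hM : 0 ≤ M) (hβ : 0 < β) :
    ∫ s in (0 : ℝ)..t, M * Real.exp (β * s) ≤ M * Real.exp (β * t) / β := by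
  have hderiv : ∀ s ∈ uIcc 0 t, HasDerivAt (fun s => M * Real.exp (β * s) / β) (M * Real.exp (β * s)) s := by
    intro s _
    have h := (((hasDerivAt_id s).const_mul β).exp.const_mul M).div_const β
    refine h.congr_deriv ?_
    simp only [id_eq, mul_one]
    field_simp
  rw [intervalIntegral.integral_eq_sub_of_hasDerivAt hderiv
    ((continuous_const.mul (Real.continuous_exp.comp (continuous_const.mul continuous_id))).intervalIntegrable _ _)]
  simp only [mul_zero, Real.exp_zero, mul_one]
  have : 0 ≤ M / β := div_nonneg hM hβ.le
  linarith

end Ineq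

/-! ## Level-zero bounds for the Duhamel formula -/

section Bounds

variable {Λ Γ : ℝ × E × E → ℝ} {f₀ : E × E → ℝ}

omit [FiniteDimensional ℝ E] in
/-- The absorption factors are at most one when `Λ ≥ 0` on `[0, T]`. [folklore] -/
theorem exp_neg_absorption_le_one {T : ℝ}
    (hΛ0 : ∀ s ∈ Icc (0 : ℝ) T, ∀ x v, 0 ≤ Λ (s, x, v)) {s t : ℝ} (hs : 0 ≤ s) (hst : s ≤ t) (ht : t ≤ T)
    (x v : E) : Real.exp (-(∫ σ in s..t, Λ (σ, x - (t - σ) • v, v))) ≤ 1 := by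
  rw [Real.exp_le_one_iff, neg_nonpos]
  refine intervalIntegral.integral_nonneg hst fun σ hσ => hΛ0 σ ⟨hs.trans hσ.1, hσ.2.trans ht⟩ _ _

/-- **Weighted sup bound at level zero.** If `Λ ≥ 0` on `[0, T]`, `(1+‖z‖)^k |f₀ z| ≤ F₀` and
`(1+‖(x,v)‖)^k |Γ(s,x,v)| ≤ M e^{βs}` on `[0, T]`, then on `[0, T]`
`(1+‖(x,v)‖)^k |U(t,x,v)| ≤ (1+T)^k (F₀ + M e^{βt}/β)`. [folklore] -/
theorem duhamel_weighted_bound_zero (hΛ : ContDiff ℝ ∞ Λ) (hΓ : ContDiff ℝ ∞ Γ) {U : ℝ × E × E → ℝ}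
    (hU : ∀ t x v, U (t, x, v) =
      f₀ (x - t • v, v) * Real.exp (-(∫ σ in (0 : ℝ)..t, Λ (σ, x - (t - σ) • v, v))) +
        ∫ s in (0 : ℝ)..t, Real.exp (-(∫ σ in s..t, Λ (σ, x - (t - σ) • v, v))) * Γ (s, x - (t - s) • v, v))
    {T : ℝ} (hT : 0 ≤ T) (k : ℕ) (hΛ0 : ∀ s ∈ Icc (0 : ℝ) T, ∀ x v, 0 ≤ Λ (s, x, v))
    {F₀ : ℝ} (hF₀ : ∀ z : E × E, (1 + ‖z‖) ^ k * |f₀ z| ≤ F₀)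
    {M β : ℝ} (hM : 0 ≤ M) (hβ : 0 < β)
    (hΓb : ∀ s ∈ Icc (0 : ℝ) T, ∀ x v, (1 + ‖(x, v)‖) ^ k * |Γ (s, x, v)| ≤ M * Real.exp (β * s)) :
    ∀ t ∈ Icc (0 : ℝ) T, ∀ x v,
      (1 + ‖(x, v)‖) ^ k * |U (t, x, v)| ≤ (1 + T) ^ k * (F₀ + M * Real.exp (β * t) / β) := by
  intro t ht x v
  have ht0 := ht.1
  have hwk := fun (τ : ℝ) (hτ : |τ| ≤ T) => weight_le_shift x v hτ k
  -- the first term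
  have h1 : (1 + ‖(x, v)‖) ^ k * |f₀ (x - t • v, v) * Real.exp (-(∫ σ in (0 : ℝ)..t, Λ (σ, x - (t - σ) • v, v)))| ≤
      (1 + T) ^ k * F₀ := by
    rw [abs_mul, abs_of_pos (Real.exp_pos _)]
    calc (1 + ‖(x, v)‖) ^ k * (|f₀ (x - t • v, v)| * Real.exp (-(∫ σ in (0 : ℝ)..t, Λ (σ, x - (t - σ) • v, v))))
        ≤ (1 + ‖(x, v)‖) ^ k * (|f₀ (x - t • v, v)| * 1) := by
          refine mul_le_mul_of_nonneg_left (mul_le_mul_of_nonneg_left ?_ (abs_nonneg _)) (by positivity)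
          have := exp_neg_absorption_le_one hΛ0 le_rfl ht0 ht.2 x v
          simpa using this
      _ ≤ (1 + T) ^ k * (1 + ‖(x - t • v, v)‖) ^ k * |f₀ (x - t • v, v)| := by
          rw [mul_one]
          exact mul_le_mul_of_nonneg_right (hwk t (by rw [abs_of_nonneg ht0]; exact ht.2)) (abs_nonneg _)
      _ ≤ (1 + T) ^ k * F₀ := by rw [mul_assoc]; exact mul_le_mul_of_nonneg_left (hF₀ _) (by positivity)
  -- the Duhamel term, pointwise in `s`
  have h2 : ∀ s ∈ Icc (0 : ℝ) t, (1 + ‖(x, v)‖) ^ k *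
      |Real.exp (-(∫ σ in s..t, Λ (σ, x - (t - σ) • v, v))) * Γ (s, x - (t - s) • v, v)| ≤
      (1 + T) ^ k * (M * Real.exp (β * s)) := by
    intro s hs
    rw [abs_mul, abs_of_pos (Real.exp_pos _)]
    have hE := exp_neg_absorption_le_one hΛ0 hs.1 hs.2 ht.2 x v
    calc (1 + ‖(x, v)‖) ^ k * (Real.exp (-(∫ σ in s..t, Λ (σ, x - (t - σ) • v, v))) * |Γ (s, x - (t - s) • v, v)|)
        ≤ (1 + ‖(x, v)‖) ^ k * (1 * |Γ (s, x - (t - s) • v, v)|) :=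
          mul_le_mul_of_nonneg_left (mul_le_mul_of_nonneg_right hE (abs_nonneg _)) (by positivity)
      _ ≤ (1 + T) ^ k * (1 + ‖(x - (t - s) • v, v)‖) ^ k * |Γ (s, x - (t - s) • v, v)| := by
          rw [one_mul]
          refine mul_le_mul_of_nonneg_right (hwk (t - s) ?_) (abs_nonneg _)
          rw [abs_of_nonneg (by linarith [hs.2])]; linarith [hs.1, ht.2]
      _ ≤ (1 + T) ^ k * (M * Real.exp (β * s)) := by
          rw [mul_assoc]
          exact mul_le_mul_of_nonneg_left (hΓb s ⟨hs.1, hs.2.trans ht.2⟩ _ _) (by positivity)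
  -- integrate
  have hcont : Continuous fun s => Real.exp (-(∫ σ in s..t, Λ (σ, x - (t - σ) • v, v))) * Γ (s, x - (t - s) • v, v) := by
    have hK : ContDiff ℝ ∞ fun q : ℝ × ℝ × E × E =>
        Real.exp (-(∫ σ in q.1..q.2.1, Λ (σ, q.2.2.1 - (q.2.1 - σ) • q.2.2.2, q.2.2.2))) *
          Γ (q.1, q.2.2.1 - (q.2.1 - q.1) • q.2.2.2, q.2.2.2) := by
      refine (Real.contDiff_exp.comp (contDiff_absorptionIntegral₂ hΛ).neg).mul (hΓ.comp ?_)
      exact contDiff_fst.prodMk (((contDiff_fst.comp (contDiff_snd.comp contDiff_snd)).sub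
        ((contDiff_fst.comp contDiff_snd).sub contDiff_fst |>.smul
          (contDiff_snd.comp (contDiff_snd.comp contDiff_snd)))).prodMk
        (contDiff_snd.comp (contDiff_snd.comp contDiff_snd)))
    exact hK.continuous.comp (continuous_id.prodMk continuous_const : Continuous fun s : ℝ => (s, t, x, v))
  have hint : |∫ s in (0 : ℝ)..t, Real.exp (-(∫ σ in s..t, Λ (σ, x - (t - σ) • v, v))) * Γ (s, x - (t - s) • v, v)| ≤
      ∫ s in (0 : ℝ)..t, |Real.exp (-(∫ σ in s..t, Λ (σ, x - (t - σ) • v, v))) * Γ (s, x - (t - s) • v, v)| :=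
    intervalIntegral.abs_integral_le_integral_abs ht0
  have hI : (1 + ‖(x, v)‖) ^ k * ∫ s in (0 : ℝ)..t,
      |Real.exp (-(∫ σ in s..t, Λ (σ, x - (t - σ) • v, v))) * Γ (s, x - (t - s) • v, v)| ≤
      (1 + T) ^ k * (M * Real.exp (β * t) / β) := by
    rw [← intervalIntegral.integral_const_mul]
    calc ∫ s in (0 : ℝ)..t, (1 + ‖(x, v)‖) ^ k *
          |Real.exp (-(∫ σ in s..t, Λ (σ, x - (t - σ) • v, v))) * Γ (s, x - (t - s) • v, v)|
        ≤ ∫ s in (0 : ℝ)..t, (1 + T) ^ k * (M * Real.exp (β * s)) := by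
          refine intervalIntegral.integral_mono_on ht0 ((continuous_const.mul hcont.abs).intervalIntegrable _ _)
            ((continuous_const.mul (continuous_const.mul (Real.continuous_exp.comp
              (continuous_const.mul continuous_id)))).intervalIntegrable _ _) fun s hs => h2 s hs
      _ = (1 + T) ^ k * ∫ s in (0 : ℝ)..t, M * Real.exp (β * s) := intervalIntegral.integral_const_mul _ _
      _ ≤ (1 + T) ^ k * (M * Real.exp (β * t) / β) :=
          mul_le_mul_of_nonneg_left (integral_exp_mul_le hM hβ) (by positivity)
  rw [hU]
  calc (1 + ‖(x, v)‖) ^ k * |f₀ (x - t • v, v) * Real.exp (-(∫ σ in (0 : ℝ)..t, Λ (σ, x - (t - σ) • v, v))) +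
        ∫ s in (0 : ℝ)..t, Real.exp (-(∫ σ in s..t, Λ (σ, x - (t - σ) • v, v))) * Γ (s, x - (t - s) • v, v)|
      ≤ (1 + ‖(x, v)‖) ^ k * |f₀ (x - t • v, v) * Real.exp (-(∫ σ in (0 : ℝ)..t, Λ (σ, x - (t - σ) • v, v)))| +
          (1 + ‖(x, v)‖) ^ k * ∫ s in (0 : ℝ)..t,
            |Real.exp (-(∫ σ in s..t, Λ (σ, x - (t - σ) • v, v))) * Γ (s, x - (t - s) • v, v)| := by
        rw [← mul_add]
        exact mul_le_mul_of_nonneg_left ((abs_add_le _ _).trans (add_le_add le_rfl hint)) (by positivity)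
    _ ≤ (1 + T) ^ k * F₀ + (1 + T) ^ k * (M * Real.exp (β * t) / β) := add_le_add h1 hI
    _ = _ := by ring

omit [FiniteDimensional ℝ E] in
/-- **Positivity**: if `f₀ ≥ 0`, `Γ ≥ 0` and `Λ ≤ C₀` on `[0, T]`, then
`U(t,x,v) ≥ f₀(x - tv, v) e^{-C₀ t}` on `[0, T]`. [folklore] -/
theorem duhamel_lower_bound (hΛ : ContDiff ℝ ∞ Λ) {U : ℝ × E × E → ℝ}
    (hU : ∀ t x v, U (t, x, v) =
      f₀ (x - t • v, v) * Real.exp (-(∫ σ in (0 : ℝ)..t, Λ (σ, x - (t - σ) • v, v))) +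
        ∫ s in (0 : ℝ)..t, Real.exp (-(∫ σ in s..t, Λ (σ, x - (t - σ) • v, v))) * Γ (s, x - (t - s) • v, v))
    {T : ℝ} (hf₀ : ∀ z, 0 ≤ f₀ z) (hΓ0 : ∀ s ∈ Icc (0 : ℝ) T, ∀ x v, 0 ≤ Γ (s, x, v))
    {C₀ : ℝ} (hΛC : ∀ s ∈ Icc (0 : ℝ) T, ∀ x v, Λ (s, x, v) ≤ C₀) :
    ∀ t ∈ Icc (0 : ℝ) T, ∀ x v, f₀ (x - t • v, v) * Real.exp (-(C₀ * t)) ≤ U (t, x, v) := by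
  intro t ht x v
  rw [hU]
  have hc2 : Continuous fun σ : ℝ => Λ (σ, x - (t - σ) • v, v) := hΛ.continuous.comp (continuous_id.prodMk
    ((continuous_const.sub ((continuous_const.sub continuous_id).smul continuous_const)).prodMk continuous_const))
  have h1 : Real.exp (-(C₀ * t)) ≤ Real.exp (-(∫ σ in (0 : ℝ)..t, Λ (σ, x - (t - σ) • v, v))) := by
    refine Real.exp_le_exp.2 (neg_le_neg ?_)
    calc ∫ σ in (0 : ℝ)..t, Λ (σ, x - (t - σ) • v, v) ≤ ∫ _σ in (0 : ℝ)..t, C₀ :=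
          intervalIntegral.integral_mono_on ht.1 (hc2.intervalIntegrable _ _) intervalIntegrable_const
            fun σ hσ => hΛC σ ⟨hσ.1, hσ.2.trans ht.2⟩ _ _
      _ = C₀ * t := by simp [mul_comm]
  have h2 : 0 ≤ ∫ s in (0 : ℝ)..t, Real.exp (-(∫ σ in s..t, Λ (σ, x - (t - σ) • v, v))) * Γ (s, x - (t - s) • v, v) :=
    intervalIntegral.integral_nonneg ht.1 fun s hs =>
      mul_nonneg (Real.exp_pos _).le (hΓ0 s ⟨hs.1, hs.2.trans ht.2⟩ _ _)
  nlinarith [hf₀ (x - t • v, v), mul_le_mul_of_nonneg_left h1 (hf₀ (x - t • v, v))]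

/-- **Weighted difference bound at level zero.** For two systems `(Λ, Γ, U)`, `(Λ', Γ', U')` with
the same datum, `Λ, Λ' ≥ 0` on `[0, T]`, `(1+‖z‖)^K |f₀| ≤ F₀`, `(1+‖z‖)^K |Γ'| ≤ G'` on `[0,T]`,
and differences `|Λ - Λ'| ≤ N s^m`, `(1+‖z‖)^K |Γ - Γ'| ≤ N s^m` on `[0, T]`:
`(1+‖z‖)^K |U - U'|(t) ≤ (1+T)^K (F₀ + 1 + G' T) N t^{m+1}/(m+1)` on `[0, T]`. [folklore] -/
theorem duhamel_weighted_diff_zero (hΛ : ContDiff ℝ ∞ Λ) (hΓ : ContDiff ℝ ∞ Γ)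
    {Λ' Γ' : ℝ × E × E → ℝ} (hΛ' : ContDiff ℝ ∞ Λ') (hΓ' : ContDiff ℝ ∞ Γ') {U U' : ℝ × E × E → ℝ}
    (hU : ∀ t x v, U (t, x, v) =
      f₀ (x - t • v, v) * Real.exp (-(∫ σ in (0 : ℝ)..t, Λ (σ, x - (t - σ) • v, v))) +
        ∫ s in (0 : ℝ)..t, Real.exp (-(∫ σ in s..t, Λ (σ, x - (t - σ) • v, v))) * Γ (s, x - (t - s) • v, v))
    (hU' : ∀ t x v, U' (t, x, v) =
      f₀ (x - t • v, v) * Real.exp (-(∫ σ in (0 : ℝ)..t, Λ' (σ, x - (t - σ) • v, v))) +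
        ∫ s in (0 : ℝ)..t, Real.exp (-(∫ σ in s..t, Λ' (σ, x - (t - σ) • v, v))) * Γ' (s, x - (t - s) • v, v))
    {T : ℝ} (hT : 0 ≤ T) (K : ℕ)
    (hΛ0 : ∀ s ∈ Icc (0 : ℝ) T, ∀ x v, 0 ≤ Λ (s, x, v)) (hΛ'0 : ∀ s ∈ Icc (0 : ℝ) T, ∀ x v, 0 ≤ Λ' (s, x, v))
    {F₀ : ℝ} (hF₀ : ∀ z : E × E, (1 + ‖z‖) ^ K * |f₀ z| ≤ F₀)
    {G' : ℝ} (hG' : ∀ s ∈ Icc (0 : ℝ) T, ∀ x v, (1 + ‖(x, v)‖) ^ K * |Γ' (s, x, v)| ≤ G')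
    {N : ℝ} (hN : 0 ≤ N) (m : ℕ)
    (hdΛ : ∀ s ∈ Icc (0 : ℝ) T, ∀ x v, |Λ (s, x, v) - Λ' (s, x, v)| ≤ N * s ^ m)
    (hdΓ : ∀ s ∈ Icc (0 : ℝ) T, ∀ x v, (1 + ‖(x, v)‖) ^ K * |Γ (s, x, v) - Γ' (s, x, v)| ≤ N * s ^ m) :
    ∀ t ∈ Icc (0 : ℝ) T, ∀ x v,
      (1 + ‖(x, v)‖) ^ K * |U (t, x, v) - U' (t, x, v)| ≤
        (1 + T) ^ K * (F₀ + 1 + G' * T) * (N * t ^ (m + 1) / (m + 1)) := by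
  intro t ht x v
  have ht0 := ht.1
  have hF₀0 : 0 ≤ F₀ := le_trans (by positivity) (hF₀ (x, v))
  have hG'0 : 0 ≤ G' := le_trans (by positivity) (hG' t ht x v)
  have hwk := fun (τ : ℝ) (hτ : |τ| ≤ T) => weight_le_shift x v hτ K
  -- continuity of the absorption integrands along the characteristic
  have hcΛ : ∀ {L : ℝ × E × E → ℝ}, ContDiff ℝ ∞ L → Continuous fun σ : ℝ => L (σ, x - (t - σ) • v, v) :=
    fun hL => hL.continuous.comp (continuous_id.prodMk
      ((continuous_const.sub ((continuous_const.sub continuous_id).smul continuous_const)).prodMk continuous_const))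
  -- the primitive `Φ(r) = ∫₀ʳ N s^m = N r^{m+1}/(m+1)` and the difference of absorption integrals
  have hΦ : ∀ r, ∫ s in (0 : ℝ)..r, N * s ^ m = N * r ^ (m + 1) / (m + 1) := fun r => by
    rw [intervalIntegral.integral_const_mul, integral_pow]; ring
  have hΦmono : ∀ {a b : ℝ}, 0 ≤ a → a ≤ b → b ≤ t →
      ∫ s in a..b, N * s ^ m ≤ N * t ^ (m + 1) / (m + 1) := by
    intro a b ha hab hbt
    calc ∫ s in a..b, N * s ^ m ≤ ∫ s in (0 : ℝ)..t, N * s ^ m := by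
          refine intervalIntegral.integral_mono_interval ha hab hbt ?_
            ((continuous_const.mul (continuous_pow m)).intervalIntegrable _ _)
          exact (ae_restrict_mem measurableSet_Ioc).mono fun s hs => mul_nonneg hN (pow_nonneg hs.1.le _)
      _ = _ := hΦ t
  set Φt : ℝ := N * t ^ (m + 1) / (m + 1) with hΦt
  have hΦt0 : 0 ≤ Φt := by rw [hΦt]; positivity
  -- absorption integrals and their difference
  set J : ℝ → ℝ := fun s => ∫ σ in s..t, Λ (σ, x - (t - σ) • v, v) with hJdef
  set J' : ℝ → ℝ := fun s => ∫ σ in s..t, Λ' (σ, x - (t - σ) • v, v) with hJ'def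
  have hJdiff : ∀ s ∈ Icc (0 : ℝ) t, |Real.exp (-J s) - Real.exp (-J' s)| ≤ Φt := by
    intro s hs
    have hJ0 : 0 ≤ J s := intervalIntegral.integral_nonneg hs.2 fun σ hσ =>
      hΛ0 σ ⟨hs.1.trans hσ.1, hσ.2.trans ht.2⟩ _ _
    have hJ'0 : 0 ≤ J' s := intervalIntegral.integral_nonneg hs.2 fun σ hσ =>
      hΛ'0 σ ⟨hs.1.trans hσ.1, hσ.2.trans ht.2⟩ _ _
    refine (Literature.NumberTheory.LFunctions.abs_exp_neg_sub_exp_neg_le hJ0 hJ'0).trans ?_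
    have hsub : J s - J' s = ∫ σ in s..t, (Λ (σ, x - (t - σ) • v, v) - Λ' (σ, x - (t - σ) • v, v)) :=
      (intervalIntegral.integral_sub ((hcΛ hΛ).intervalIntegrable _ _) ((hcΛ hΛ').intervalIntegrable _ _)).symm
    rw [hsub]
    calc |∫ σ in s..t, (Λ (σ, x - (t - σ) • v, v) - Λ' (σ, x - (t - σ) • v, v))|
        ≤ ∫ σ in s..t, |Λ (σ, x - (t - σ) • v, v) - Λ' (σ, x - (t - σ) • v, v)| :=
          intervalIntegral.abs_integral_le_integral_abs hs.2
      _ ≤ ∫ σ in s..t, N * σ ^ m := by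
          refine intervalIntegral.integral_mono_on hs.2 (((hcΛ hΛ).sub (hcΛ hΛ')).abs.intervalIntegrable _ _)
            ((continuous_const.mul (continuous_pow m)).intervalIntegrable _ _) fun σ hσ => ?_
          exact hdΛ σ ⟨hs.1.trans hσ.1, hσ.2.trans ht.2⟩ _ _
      _ ≤ Φt := hΦmono hs.1 hs.2 le_rfl
  -- the first term
  have h1 : (1 + ‖(x, v)‖) ^ K * |f₀ (x - t • v, v) * Real.exp (-J 0) - f₀ (x - t • v, v) * Real.exp (-J' 0)| ≤
      (1 + T) ^ K * F₀ * Φt := by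
    rw [← mul_sub, abs_mul]
    calc (1 + ‖(x, v)‖) ^ K * (|f₀ (x - t • v, v)| * |Real.exp (-J 0) - Real.exp (-J' 0)|)
        ≤ ((1 + T) ^ K * (1 + ‖(x - t • v, v)‖) ^ K) * (|f₀ (x - t • v, v)| * Φt) := by
          refine mul_le_mul (hwk t (by rw [abs_of_nonneg ht0]; exact ht.2))
            (mul_le_mul_of_nonneg_left (hJdiff 0 ⟨le_rfl, ht0⟩) (abs_nonneg _)) (by positivity) (by positivity)
      _ = (1 + T) ^ K * ((1 + ‖(x - t • v, v)‖) ^ K * |f₀ (x - t • v, v)|) * Φt := by ring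
      _ ≤ (1 + T) ^ K * F₀ * Φt := by gcongr; exact hF₀ _
  -- the Duhamel terms, pointwise
  have h2 : ∀ s ∈ Icc (0 : ℝ) t, (1 + ‖(x, v)‖) ^ K *
      |Real.exp (-J s) * Γ (s, x - (t - s) • v, v) - Real.exp (-J' s) * Γ' (s, x - (t - s) • v, v)| ≤
      (1 + T) ^ K * (N * s ^ m + Φt * G') := by
    intro s hs
    have hE : Real.exp (-J s) ≤ 1 := exp_neg_absorption_le_one hΛ0 hs.1 hs.2 ht.2 x v
    have hsT : |t - s| ≤ T := by rw [abs_of_nonneg (by linarith [hs.2])]; linarith [hs.1, ht.2]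
    have hsplit : Real.exp (-J s) * Γ (s, x - (t - s) • v, v) - Real.exp (-J' s) * Γ' (s, x - (t - s) • v, v) =
        Real.exp (-J s) * (Γ (s, x - (t - s) • v, v) - Γ' (s, x - (t - s) • v, v)) +
          (Real.exp (-J s) - Real.exp (-J' s)) * Γ' (s, x - (t - s) • v, v) := by ring
    rw [hsplit]
    have hsI : s ∈ Icc (0 : ℝ) T := ⟨hs.1, hs.2.trans ht.2⟩
    calc (1 + ‖(x, v)‖) ^ K * |Real.exp (-J s) * (Γ (s, x - (t - s) • v, v) - Γ' (s, x - (t - s) • v, v)) +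
          (Real.exp (-J s) - Real.exp (-J' s)) * Γ' (s, x - (t - s) • v, v)|
        ≤ (1 + ‖(x, v)‖) ^ K * (1 * |Γ (s, x - (t - s) • v, v) - Γ' (s, x - (t - s) • v, v)| +
            Φt * |Γ' (s, x - (t - s) • v, v)|) := by
          refine mul_le_mul_of_nonneg_left ((abs_add_le _ _).trans (add_le_add ?_ ?_)) (by positivity)
          · rw [abs_mul, abs_of_pos (Real.exp_pos _)]
            exact mul_le_mul_of_nonneg_right hE (abs_nonneg _)
          · rw [abs_mul]
            exact mul_le_mul_of_nonneg_right (hJdiff s hs) (abs_nonneg _)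
      _ = (1 + ‖(x, v)‖) ^ K * |Γ (s, x - (t - s) • v, v) - Γ' (s, x - (t - s) • v, v)| +
            Φt * ((1 + ‖(x, v)‖) ^ K * |Γ' (s, x - (t - s) • v, v)|) := by ring
      _ ≤ (1 + T) ^ K * ((1 + ‖(x - (t - s) • v, v)‖) ^ K * |Γ (s, x - (t - s) • v, v) - Γ' (s, x - (t - s) • v, v)|) +
            Φt * ((1 + T) ^ K * ((1 + ‖(x - (t - s) • v, v)‖) ^ K * |Γ' (s, x - (t - s) • v, v)|)) := by
          refine add_le_add ?_ (mul_le_mul_of_nonneg_left ?_ hΦt0)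
          · rw [← mul_assoc]; exact mul_le_mul_of_nonneg_right (hwk _ hsT) (abs_nonneg _)
          · rw [← mul_assoc]; exact mul_le_mul_of_nonneg_right (hwk _ hsT) (abs_nonneg _)
      _ ≤ (1 + T) ^ K * (N * s ^ m) + Φt * ((1 + T) ^ K * G') :=
          add_le_add (mul_le_mul_of_nonneg_left (hdΓ s hsI _ _) (by positivity))
            (mul_le_mul_of_nonneg_left (mul_le_mul_of_nonneg_left (hG' s hsI _ _) (by positivity)) hΦt0)
      _ = (1 + T) ^ K * (N * s ^ m + Φt * G') := by ring
  -- integrate the Duhamel terms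
  have hKc : ∀ {L Gm : ℝ × E × E → ℝ}, ContDiff ℝ ∞ L → ContDiff ℝ ∞ Gm →
      Continuous fun s => Real.exp (-(∫ σ in s..t, L (σ, x - (t - σ) • v, v))) * Gm (s, x - (t - s) • v, v) := by
    intro L Gm hL hGm
    have hK : ContDiff ℝ ∞ fun q : ℝ × ℝ × E × E =>
        Real.exp (-(∫ σ in q.1..q.2.1, L (σ, q.2.2.1 - (q.2.1 - σ) • q.2.2.2, q.2.2.2))) *
          Gm (q.1, q.2.2.1 - (q.2.1 - q.1) • q.2.2.2, q.2.2.2) := by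
      refine (Real.contDiff_exp.comp (contDiff_absorptionIntegral₂ hL).neg).mul (hGm.comp ?_)
      exact contDiff_fst.prodMk (((contDiff_fst.comp (contDiff_snd.comp contDiff_snd)).sub
        ((contDiff_fst.comp contDiff_snd).sub contDiff_fst |>.smul
          (contDiff_snd.comp (contDiff_snd.comp contDiff_snd)))).prodMk
        (contDiff_snd.comp (contDiff_snd.comp contDiff_snd)))
    exact hK.continuous.comp (continuous_id.prodMk continuous_const : Continuous fun s : ℝ => (s, t, x, v))
  have hc1 := hKc hΛ hΓ
  have hc2 := hKc hΛ' hΓ'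
  have hI : (1 + ‖(x, v)‖) ^ K *
      |(∫ s in (0 : ℝ)..t, Real.exp (-J s) * Γ (s, x - (t - s) • v, v)) -
        ∫ s in (0 : ℝ)..t, Real.exp (-J' s) * Γ' (s, x - (t - s) • v, v)| ≤
      (1 + T) ^ K * (Φt + Φt * G' * t) := by
    rw [← intervalIntegral.integral_sub (hc1.intervalIntegrable _ _) (hc2.intervalIntegrable _ _)]
    calc (1 + ‖(x, v)‖) ^ K * |∫ s in (0 : ℝ)..t, (Real.exp (-J s) * Γ (s, x - (t - s) • v, v) -
          Real.exp (-J' s) * Γ' (s, x - (t - s) • v, v))|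
        ≤ (1 + ‖(x, v)‖) ^ K * ∫ s in (0 : ℝ)..t, |Real.exp (-J s) * Γ (s, x - (t - s) • v, v) -
            Real.exp (-J' s) * Γ' (s, x - (t - s) • v, v)| :=
          mul_le_mul_of_nonneg_left (intervalIntegral.abs_integral_le_integral_abs ht0) (by positivity)
      _ = ∫ s in (0 : ℝ)..t, (1 + ‖(x, v)‖) ^ K * |Real.exp (-J s) * Γ (s, x - (t - s) • v, v) -
            Real.exp (-J' s) * Γ' (s, x - (t - s) • v, v)| := (intervalIntegral.integral_const_mul _ _).symm
      _ ≤ ∫ s in (0 : ℝ)..t, (1 + T) ^ K * (N * s ^ m + Φt * G') :=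
          intervalIntegral.integral_mono_on ht0 ((continuous_const.mul (hc1.sub hc2).abs).intervalIntegrable _ _)
            ((continuous_const.mul ((continuous_const.mul (continuous_pow m)).add continuous_const)).intervalIntegrable _ _)
            fun s hs => h2 s hs
      _ = (1 + T) ^ K * ((∫ s in (0 : ℝ)..t, N * s ^ m) + Φt * G' * t) := by
          have e : ∫ s in (0 : ℝ)..t, (N * s ^ m + Φt * G') = (∫ s in (0 : ℝ)..t, N * s ^ m) + Φt * G' * t := by
            have hf : IntervalIntegrable (fun s : ℝ => N * s ^ m) volume 0 t :=
              (continuous_const.mul (continuous_pow m)).intervalIntegrable _ _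
            have hg : IntervalIntegrable (fun _ : ℝ => Φt * G') volume 0 t := intervalIntegrable_const
            rw [intervalIntegral.integral_add hf hg, intervalIntegral.integral_const, smul_eq_mul, sub_zero]
            ring
          rw [intervalIntegral.integral_const_mul, e]
      _ ≤ (1 + T) ^ K * (Φt + Φt * G' * t) := by
          refine mul_le_mul_of_nonneg_left (add_le_add ?_ le_rfl) (by positivity)
          rw [hΦ t]
  -- assemble
  have hUU' : U (t, x, v) - U' (t, x, v) =
      (f₀ (x - t • v, v) * Real.exp (-J 0) - f₀ (x - t • v, v) * Real.exp (-J' 0)) +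
        ((∫ s in (0 : ℝ)..t, Real.exp (-J s) * Γ (s, x - (t - s) • v, v)) -
          ∫ s in (0 : ℝ)..t, Real.exp (-J' s) * Γ' (s, x - (t - s) • v, v)) := by
    rw [hU, hU']; ring
  rw [hUU']
  calc (1 + ‖(x, v)‖) ^ K * |(f₀ (x - t • v, v) * Real.exp (-J 0) - f₀ (x - t • v, v) * Real.exp (-J' 0)) +
        ((∫ s in (0 : ℝ)..t, Real.exp (-J s) * Γ (s, x - (t - s) • v, v)) -
          ∫ s in (0 : ℝ)..t, Real.exp (-J' s) * Γ' (s, x - (t - s) • v, v))|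
      ≤ (1 + T) ^ K * F₀ * Φt + (1 + T) ^ K * (Φt + Φt * G' * t) := by
        rw [← sub_nonneg]
        have := abs_add_le (f₀ (x - t • v, v) * Real.exp (-J 0) - f₀ (x - t • v, v) * Real.exp (-J' 0))
          ((∫ s in (0 : ℝ)..t, Real.exp (-J s) * Γ (s, x - (t - s) • v, v)) -
            ∫ s in (0 : ℝ)..t, Real.exp (-J' s) * Γ' (s, x - (t - s) • v, v))
        have h0 : 0 ≤ (1 + ‖(x, v)‖) ^ K := by positivity
        nlinarith [h1, hI, mul_le_mul_of_nonneg_left this h0]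
    _ ≤ (1 + T) ^ K * (F₀ + 1 + G' * T) * Φt := by
        have hΦG : Φt * G' * t ≤ Φt * G' * T := mul_le_mul_of_nonneg_left ht.2 (mul_nonneg hΦt0 hG'0)
        nlinarith [hΦG, pow_nonneg (by linarith : (0 : ℝ) ≤ 1 + T) K]

end Bounds

end Literature.MathematicalPhysics.KineticTheory

end
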